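import Summits.SmoothPoincare4.SmoothPoincare4.Theses.EllipticRuledHost
import Literature.Topology.FourManifolds.SPC4Handles
import HarnessLib
import HarnessLib.Audit

/-!
# Birth skeleton (BC3) for crux `EllipticRuledHost.CappingRecogniser` (item stmt-SmoothPoincare4-13710)

`Cruxes/CappingRecogniser/Lines/birth.lean` · registrar planner-skel-stmt-SmoothPoincare4-13710-0 ·
2026-08-17 · mode skeleton-register (route re-audit bin REPAIRABLE; route
`route-SmoothPoincare4-EllipticRuledHost`, crux rank 2).  The crux is FIXED and is concluded BY NAME:

  `Summit.SmoothPoincare4.SmoothPoincare4.Theses.EllipticRuledHost.CappingRecogniser`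

CAPPING RECOGNISER: for a smooth homotopy 4-sphere `Σ = (M, e : M ≃ₕ S⁴)` (bare binders of the
Statement), if some closed Kervaire–Milnor sum `P = Σ # H`, `H = S² × T²` the elliptic ruled surface,
presented by gluing data `(i₁, i₂, jA, jB)` with base points `s₀, t₀` off the disc centre `i₂ 0`,
carries a symplectic form `sf` for which the summand's fibre sphere `jB(S² × {t₀})` and section torus
`jB({s₀} × T²)` are symplectic and `sf`-orthogonal at their crossing, then `Σ ≅ S⁴`.

## The cut — the route's own two-layer plan, typed (McDuff ruling ∘ product model ∘ complement ∘ LP)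

The route header (TWO-LAYER PLAN) foresees `CappingRecogniser ⇐ McDuffSectionRuling → LPCapping`.
This skeleton types that plan as FOUR registered stubs, each handing the next a different object
(a submersion `π : P → T²` ↦ a diffeomorphism of triples `Φ` ↦ a 1-handlebody sum `V = Y # M ≅ Y`
↦ `M ≅ S⁴`), so that the symplectic heart, the bundle topology, the complement computation and the
Laudenbach–Poénaru cancellation can be staffed by different hands:

* `stub_ruling` (OPEN as a formal object, TRUE at theorem level — the J-HOLOMORPHIC HEART; XL):
  under the crux's hypotheses for `(M, e)` and given data `(P, i₁, i₂, jA, jB, s₀, t₀, sf)`, the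
  host sum `P` FIBRES OVER THE TORUS: there is a smooth submersion `π : P → T²` for which the marked
  torus is a section on the nose (`π (jB (s₀, t)) = t`) and the marked sphere is exactly the fibre
  over `t₀`.  Content: an `sf`-tame `J` with `jB F`, `jB T` both `J`-holomorphic (they are
  symplectic and `sf`-orthogonal at the single crossing); `(P, sf)` is minimal (even intersection
  form, `b₂ = 2` hyperbolic) so McDuff's theorem (Wendl 2018, Thm. D/E, §1.3.2; McDuff 1990;
  McDuff–Salamon 2017 §4.1 (v)–(vi)) rules `P` by embedded `J`-spheres in the class of `jB F`, with
  `jB F` a leaf; positivity of intersections and `[T]·[F] = 1` make the `J`-torus meet every leaf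
  once transversally, so leaf ↦ its point on the torus is the submersion `π` (base re-parametrised
  by the torus itself).  Why it might fail: only as "unprinted as stated" (one tame `J` through BOTH
  surfaces, compactness in class `[F]` for that `J`, automatic transversality) — the route's own
  `why_might_fail` of the crux; Lean has no `J`-curves (XL).
* `stub_productModel` (KNOWN mathematics; L–XL to formalise — BUNDLE TOPOLOGY): a compact `P`
  containing an open copy `jB` of the punctured `S² × T²`, submersed onto `T²` with the marked
  sphere a fibre and the marked torus a section, is the PRODUCT TRIPLE: a diffeomorphism
  `Φ : P ≅ S² × T²` carries `jB F` onto a fibre `S² × {t₁}` and `jB T` onto a straight section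
  `{s₁} × T²`.  Content: Ehresmann (proper submersion ⇒ smooth `S²`-bundle over `T²`); the section
  `jB T` has a product neighbourhood (`jB((S² ∖ {(i₂ 0).1}) × T²)`), hence self-intersection `0`,
  hence the bundle is the trivial one and the section has degree `0` (a section `T + d·F` has square
  `2d`), hence is straightened by a fibrewise rotation (Smale `Diff(S²) ≃ O(3)`; lift of a
  null-homotopic `T² → S²` to `SO(3)`).  [GompfStipsicz1999 §1.3/§3.1 (ruled surfaces), Hirsch 1976
  Ch. 4, McDuffSalamon2017 §4.1]
* `stub_complementSum` (KNOWN; L–XL — THE COMPLEMENT OF FIBRE ∪ SECTION): from the Kervaire–Milnor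
  gluing clauses of `P = M # (S² × T²)` and such a `Φ`, there are a compact connected orientable
  `1`-handlebody `Y` (the complement `S² × T² ∖ ν(S² × {t₁} ∪ {s₁} × T²) = D² × T₀ ≅ ♮2(S¹ × B³)`,
  corners smoothed) and an interior connected sum `V = Y # M` (tree `IsConnectedSum (𝓡∂ 4) (𝓡∂ 4)
  (𝓡 4) Y M V`) with `V ≅ Y`: `V` is `P ∖ ν(jB F ∪ jB T)`, which `Φ` identifies with another
  regular-neighbourhood complement of the standard pair (uniqueness of tubular neighbourhoods of the
  plumbed pair; re-presentation of the sum with small discs).  [KervaireMilnor1963 §2, Hirsch 1976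
  Ch. 4 §§5–6, GompfStipsicz1999 §4.6 (plumbings)]
* `stub_handlebodyCancellation` (KNOWN modulo Laudenbach–Poénaru; L–XL — `1`-HANDLEBODIES ABSORB NO
  CLOSED 4-MANIFOLD): if `Y` is a compact connected orientable `1`-handlebody (tree
  `IsHandlebodyOfIndexLE 3 1 Y`, `IsOrientable (𝓡∂ 4) Y`) and some interior connected sum `Y # M` is
  diffeomorphic to `Y`, then `M ≅ S⁴`.  Content: `Y ≅ ♮k(S¹ × B³) = Y₀` (uniqueness of
  `1`-handlebodies, tree `OneHandlebodyClassification.lean`), `S⁴ = Y₀ ∪_∂ Z₀` with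
  `Z₀ = ♮k(S² × D²)` a `2`-handlebody, so `M ≅ M # S⁴ ≅ (M # Y₀) ∪_∂ Z₀ ≅ Y₀ ∪_φ Z₀ ≅ S⁴` by
  Laudenbach–Poénaru (every diffeomorphism of `#k(S¹ × S²)` extends over `♮k(S¹ × B³)`; tree named
  facts `exists_diffeomorph_comp_incl_eq`, `nonempty_diffeomorph_of_isBoundaryGluing_twoHandlebody`,
  SPC4Handles.lean; `k = 0` is Cerf's `Γ₄ = 0`).  [LaudenbachPoenaruBSMF1972 Thm. A, Kirby1989 Ch. I
  §2 p. 8, GompfStipsicz1999 §4.4, CerfDiffeoSphere1968]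

`CappingRecogniser_of : Sig.stub_ruling → Sig.stub_productModel → Sig.stub_complementSum →
Sig.stub_handlebodyCancellation → CappingRecogniser` is PROVED (§3, pure logic: destructure the
crux's `∃`-bundle, feed the four stubs in order); `cappingRecogniser_of_stubs : CappingRecogniser` is
the crux by name modulo the four registered stubs.  `lean check`: sorries ONLY in the four `stub_*`.

Hardest stub: `stub_ruling` (the only one needing mathematics absent from Lean AND from the tree's
named-fact register: pseudoholomorphic curves).  The other three are classical differential topology
of sizes L–XL; `stub_handlebodyCancellation` sits directly on the tree's Laudenbach–Poénaru programme
(`SPC4Handles*.lean`, `LaudenbachPoenaruPositiveGenus.lean`).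

Honesty notes.  (1) Every stub, like the crux itself (refuter note 2026-08-15: `SmoothPoincare4 →
CappingRecogniser` proved in W3.lean), is a CONSEQUENCE of `SmoothPoincare4` at theorem level; none
is cheaply equivalent to it or to the crux (BC3 probes below).  (2) The section degree worry of the
route text ("D² × T₀ complement for every section degree") is settled inside `stub_productModel`: the
marked torus has a product neighbourhood coming from `jB`, so its square is `0` and only degree `0`
occurs.  (3) `stub_productModel` / `stub_complementSum` / `stub_handlebodyCancellation` are stated
WITHOUT the homotopy equivalence `e` and for every `M` with the Statement's instance binders: the
extra generality is harmless (a non-compact, empty or disconnected `M` makes `Y # M ≅ Y` impossible)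
and is what the proofs give.  (4) Orientation: the tree's `IsConnectedSum` is orientation-free; the
cancellation holds for either pairing because `♮k(S¹ × B³)` admits an orientation-reversing
diffeomorphism.

BC3 probes (registrar, 2026-08-17, files `bc/probe_stub_*.lean` in the registrar's folder — §0–§1 of
this file verbatim plus the probes; raw `lean check` output quoted in its NOTES.md and in the crux
evidence note): 32 probes = 4 stubs × {`→ CappingRecogniser`, `→ SmoothPoincare4`} × {`exact?`,
`simpa [Sig.stub_x, IsHostSum, target]`, `(unfold Sig.stub_x target; simpa)`, `aesop`}, one `example`
each under `maxHeartbeats 400000`: ALL FAIL — `exact?` "could not close the goal" 8/8, `aesop` "failed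
to prove the goal after exhaustive search" 8/8, `simpa` / `unfold; simpa` heartbeat time-out (14) or
`assumption` failed on the residual goal (2).  No stub is cheaply the crux or the summit.

Disproof used: none exists for this crux (`ledger crux ls stmt-SmoothPoincare4-13710`: no workfiles,
no `Disproof.lean`, no `Theorems/CappingRecogniser/Negative/*`, 2026-08-17); negatives index of the
summit consulted (`ledger negatives --problem SmoothPoincare4`).  Refuter evidence on the item
(EVIDENCE-13710.md, W3.lean, 2026-08-15: SURVIVES; not vacuous — `S⁴` witness `P = S² × T²`, product
form, `F ⊥ T`; mutation audit: `hFs`/`hTs` load-bearing) is honoured: `stub_ruling` consumes the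
symplectic clauses verbatim, and the `S⁴` witness inhabits every stub's hypotheses (`π = pr₂`,
`Φ = id`, `Y = D² × T₀`, `V = Y # S⁴`).

Barriers (route technique_class: symplectic-rigidity, host-swindle, J-curves):
`Literature.Barriers.SmoothPoincare4.GaugeSumBarrierFour` — not engaged (no gauge invariant of a sum
is evaluated; Seiberg–Witten enters nowhere in this crux); `TopologicalBarrierFour` /
`HCobordismInvariantBarrierFour` — conceded that `P` is homeomorphic to `S² × T²`; the detecting
structure (a symplectic form positive on the marked pair, then a `J`-ruling) is not a homeomorphism
invariant, so the line is outside the class; `OneStabilisationBarrier`, `GluckTwistCP2Barrier`,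
`StableBarrierFour` — not engaged (no `S² × S²`/`ℂP²` summand, no stable statement).
-/

noncomputable section

-- every `Summit.SmoothPoincare4.SmoothPoincare4.…` name repeats the summit = sub-problem segment
-- (D-0017 layout); the duplicate is deliberate.
set_option linter.dupNamespace false
set_option linter.unusedVariables false

namespace Summit.SmoothPoincare4.SmoothPoincare4.Cruxes.CappingRecogniser.Birth

open scoped Manifold ContDiff Topology
open Set Function Literature.Topology.FourManifolds
open Summit.SmoothPoincare4.SmoothPoincare4.Theses.EllipticRuledHost (CappingRecogniser)

/-- Local notation: the round circle `S¹ ⊆ ℝ²` (Mathlib's analytic manifold, model `𝓡 1`). -/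
local notation "𝕊¹" => (Metric.sphere (0 : EuclideanSpace ℝ (Fin 2)) 1)
/-- Local notation: the round `2`-sphere `S² ⊆ ℝ³` (model `𝓡 2`), fibre of the host. -/
local notation "𝕊²" => (Metric.sphere (0 : EuclideanSpace ℝ (Fin 3)) 1)
/-- Local notation: the round `4`-sphere `S⁴ ⊆ ℝ⁵` (model `𝓡 4`). -/
local notation "𝕊⁴" => (Metric.sphere (0 : EuclideanSpace ℝ (Fin 5)) 1)
/-- Local notation: the model space `ℝ⁴`. -/
local notation "𝔼⁴" => EuclideanSpace ℝ (Fin 4)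
/-- Local notation: the torus `T² = S¹ × S¹` (model `(𝓡 1).prod (𝓡 1)`), base of the host. -/
local notation "𝕋²" => (↥𝕊¹ × ↥𝕊¹)

/-! ## §0 Vocabulary — the Kervaire–Milnor gluing clauses of the crux, named -/

/-- **The gluing clauses of the crux** (its conjuncts (i)–(viii), verbatim): `P` is the Kervaire–Milnor
connected sum `M # (S² × T²)` PRESENTED by the disc embeddings `i₁ : ℝ⁴ ↪ M`, `i₂ : ℝ⁴ ↪ S² × T²` and
the open smooth embeddings `jA : M ∖ {i₁ 0} ↪ P`, `jB : (S² × T²) ∖ {i₂ 0} ↪ P` covering `P` and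
overlapping exactly along `i₁ (t • u) ∼ i₂ ((1 - t) • u)` (`‖u‖ = 1`, `0 < t < 1`).  This is the body
of `Literature.Topology.FourManifolds.IsConnectedSum (𝓡 4) (𝓡 4) ((𝓡 2).prod ((𝓡 1).prod (𝓡 1))) M (S² × T²) P` with its four
existential witnesses exposed, exactly as the route decls spell it. [cite: KervaireMilnor1963, §2] -/
def IsHostSum (M : Type) [TopologicalSpace M] [T2Space M] [ChartedSpace 𝔼⁴ M]
    (P : Type) [TopologicalSpace P] [ChartedSpace 𝔼⁴ P]
    (i₁ : 𝔼⁴ → M) (i₂ : 𝔼⁴ → ↥𝕊² × 𝕋²) (jA : ↥(puncture i₁) → P) (jB : ↥(puncture i₂) → P) : Prop :=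
  Manifold.IsSmoothEmbedding 𝓘(ℝ, 𝔼⁴) (𝓡 4) ∞ i₁ ∧ Manifold.IsSmoothEmbedding 𝓘(ℝ, 𝔼⁴) ((𝓡 2).prod ((𝓡 1).prod (𝓡 1))) ∞ i₂ ∧
    Manifold.IsSmoothEmbedding (𝓡 4) (𝓡 4) ∞ jA ∧ IsOpen (Set.range jA) ∧
    Manifold.IsSmoothEmbedding ((𝓡 2).prod ((𝓡 1).prod (𝓡 1))) (𝓡 4) ∞ jB ∧ IsOpen (Set.range jB) ∧
    Set.range jA ∪ Set.range jB = Set.univ ∧ (∀ a b, jA a = jB b ↔ connectedSumRel i₁ i₂ a b)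

/-- The relational connected sum of the route's other items follows from the presented one (sanity
check that §0 is the tree's notion with witnesses exposed). -/
theorem IsHostSum.isConnectedSum {M : Type} [TopologicalSpace M] [T2Space M] [ChartedSpace 𝔼⁴ M]
    {P : Type} [TopologicalSpace P] [ChartedSpace 𝔼⁴ P]
    {i₁ : 𝔼⁴ → M} {i₂ : 𝔼⁴ → ↥𝕊² × 𝕋²} {jA : ↥(puncture i₁) → P} {jB : ↥(puncture i₂) → P}
    (h : IsHostSum M P i₁ i₂ jA jB) : IsConnectedSum (𝓡 4) (𝓡 4) ((𝓡 2).prod ((𝓡 1).prod (𝓡 1))) M (↥𝕊² × 𝕋²) P := by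
  obtain ⟨h₁, h₂, h₃, h₄, h₅, h₆, h₇, h₈⟩ := h
  exact ⟨i₁, i₂, h₁, h₂, jA, jB, h₃, h₄, h₅, h₆, h₇, h₈⟩

/-! ## §1 The stub SIGNATURES (`Sig.stub_<name>`; the skeleton audit reads the hypotheses of
`CappingRecogniser_of` BY NAME, heads = stub names) -/

/-- **STUB 1 — THE HOST SUM IS RULED OVER THE TORUS, WITH THE MARKED TORUS A SECTION AND THE MARKED
SPHERE A FIBRE** (the `J`-holomorphic heart; McDuff 1990 / Wendl 2018 Thm. D–E, §1.3.2 /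
McDuff–Salamon 2017 §4.1 (v)–(vi)).  Hypotheses: VERBATIM those of the crux for `Σ = (M, e)`, with its
`∃`-bundle `(P, i₁, i₂, jA, jB, s₀, t₀, hF, hT, sf)` curried into binders and its fourteen clauses
(gluing (i)–(viii); `sf` smooth, closed, non-degenerate; `jB(S² × {t₀})`, `jB({s₀} × T²)` symplectic;
`sf`-orthogonal crossing) kept as one conjunction.  Conclusion: a smooth map `π : P → T²` with
everywhere-surjective differential (a submersion), `π (jB (s₀, t)) = t` for all `t` (the marked torus
is a section on the nose) and `π x = t₀ ↔ x ∈ jB(S² × {t₀})` (the marked sphere is exactly the fibre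
over `t₀`).  Proof in print: one `sf`-tame `J` making both marked surfaces `J`-holomorphic; `(P, sf)`
is minimal (even form), so the embedded `J`-sphere `jB F` of square `0` rules `P` by embedded
`J`-spheres for this `J` (no bubbling in class `[F]`, automatic transversality, positivity of
intersections); the `J`-torus meets each leaf exactly once and transversally (`[T]·[F] = 1`,
positivity), so "leaf through `x` ↦ its point on the torus ↦ `t`" is the required `π`.  Size: XL
(no pseudoholomorphic curves in Lean or in the tree).  Why it might fail: unprinted as stated (one `J`
through both surfaces; compactness in class `[F]` for that `J`), the crux's own risk line.
[McDuff1990; Wendl2018 Thm. D(1), §1.3.2; McDuffSalamon2017 §4.1; McDuff1991LocalBehaviour] -/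
def Sig.stub_ruling : Prop :=
  ∀ (M : Type) [TopologicalSpace M] [T2Space M] [SecondCountableTopology M] [ChartedSpace 𝔼⁴ M]
    [IsManifold (𝓡 4) ∞ M], ContinuousMap.HomotopyEquiv M 𝕊⁴ →
    ∀ (P : Type) [TopologicalSpace P] [T2Space P] [SecondCountableTopology P] [ChartedSpace 𝔼⁴ P]
      [IsManifold (𝓡 4) ∞ P] [CompactSpace P]
      (i₁ : 𝔼⁴ → M) (i₂ : 𝔼⁴ → ↥𝕊² × 𝕋²) (jA : ↥(puncture i₁) → P) (jB : ↥(puncture i₂) → P)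
      (s₀ : ↥𝕊²) (t₀ : 𝕋²) (hF : ∀ s : ↥𝕊², (s, t₀) ∈ puncture i₂) (hT : ∀ t : 𝕋², (s₀, t) ∈ puncture i₂)
      (sf : Literature.Geometry.Kaehler.MForm (𝓡 4) P ℝ 2),
      Manifold.IsSmoothEmbedding 𝓘(ℝ, EuclideanSpace ℝ (Fin 4)) (𝓡 4) (⊤ : ℕ∞) i₁ ∧ Manifold.IsSmoothEmbedding 𝓘(ℝ, EuclideanSpace ℝ (Fin 4)) ((𝓡 2).prod ((𝓡 1).prod (𝓡 1))) (⊤ : ℕ∞) i₂ ∧ Manifold.IsSmoothEmbedding (𝓡 4) (𝓡 4) (⊤ : ℕ∞) jA ∧ IsOpen (Set.range jA) ∧ Manifold.IsSmoothEmbedding ((𝓡 2).prod ((𝓡 1).prod (𝓡 1))) (𝓡 4) (⊤ : ℕ∞) jB ∧ IsOpen (Set.range jB) ∧ Set.range jA ∪ Set.range jB = Set.univ ∧ (∀ a b, jA a = jB b ↔ Literature.Topology.FourManifolds.connectedSumRel i₁ i₂ a b) ∧ Literature.Geometry.Kaehler.IsSmoothForm sf ∧ Literature.Geometry.Kaehler.IsClosedForm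 sf ∧ (∀ (x : P) (v : TangentSpace (𝓡 4) x), v ≠ 0 → ∃ w : TangentSpace (𝓡 4) x, sf x ![v, w] ≠ 0) ∧ (∀ s : ↥(Metric.sphere (0 : EuclideanSpace ℝ (Fin 3)) 1), ∃ a b : TangentSpace (𝓡 2) s, sf (jB ⟨(s, t₀), hF s⟩) ![mfderiv (𝓡 2) (𝓡 4) (fun s' : ↥(Metric.sphere (0 : EuclideanSpace ℝ (Fin 3)) 1) => jB ⟨(s', t₀), hF s'⟩) s a, mfderiv (𝓡 2) (𝓡 4) (fun s' : ↥(Metric.sphere (0 : EuclideanSpace ℝ (Fin 3)) 1) => jB ⟨(s', t₀), hF s'⟩) s b] ≠ 0) ∧ (∀ t : (↥(Metric.sphere (0 : EuclideanSpace ℝ (Fin 2)) 1) × ↥(Metric.sphere (0 : EuclideanSpace ℝ (Fin 2)) 1)), ∃ a b : TangentSpace ((𝓡 1).prod (𝓡 1)) t, sf (jB ⟨(s₀, t), hT t⟩) ![mfderiv ((𝓡 1).prod (𝓡 1)) (𝓡 4) (fun t' : (↥(Metric.sphere (0 : EuclideanSpace ℝ (Fin 2)) 1) × ↥(Metric.sphere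 (0 : EuclideanSpace ℝ (Fin 2)) 1)) => jB ⟨(s₀, t'), hT t'⟩) t a, mfderiv ((𝓡 1).prod (𝓡 1)) (𝓡 4) (fun t' : (↥(Metric.sphere (0 : EuclideanSpace ℝ (Fin 2)) 1) × ↥(Metric.sphere (0 : EuclideanSpace ℝ (Fin 2)) 1)) => jB ⟨(s₀, t'), hT t'⟩) t b] ≠ 0) ∧ (∀ (a : TangentSpace (𝓡 2) s₀) (b : TangentSpace ((𝓡 1).prod (𝓡 1)) t₀), sf (jB ⟨(s₀, t₀), hF s₀⟩) ![mfderiv (𝓡 2) (𝓡 4) (fun s' : ↥(Metric.sphere (0 : EuclideanSpace ℝ (Fin 3)) 1) => jB ⟨(s', t₀), hF s'⟩) s₀ a, mfderiv ((𝓡 1).prod (𝓡 1)) (𝓡 4) (fun t' : (↥(Metric.sphere (0 : EuclideanSpace ℝ (Fin 2)) 1) × ↥(Metric.sphere (0 : EuclideanSpace ℝ (Fin 2)) 1)) => jB ⟨(s₀, t'), hT t'⟩) t₀ b] = 0) →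
      ∃ π : P → 𝕋², ContMDiff (𝓡 4) ((𝓡 1).prod (𝓡 1)) ∞ π ∧
        (∀ x : P, Function.Surjective (mfderiv (𝓡 4) ((𝓡 1).prod (𝓡 1)) π x)) ∧
        (∀ t : 𝕋², π (jB ⟨(s₀, t), hT t⟩) = t) ∧
        (∀ x : P, π x = t₀ ↔ x ∈ Set.range (fun s : ↥𝕊² => jB ⟨(s, t₀), hF s⟩))

/-- **STUB 2 — A SPHERE-RULED HOST WITH THE MARKED SPHERE A FIBRE AND THE MARKED TORUS A SECTION IS
THE PRODUCT TRIPLE** (known; bundle topology).  For a compact smooth `P` (Hausdorff, second countable,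
`C^∞` on `𝓡 4`) containing an OPEN smoothly embedded copy `jB` of the punctured host
`(S² × T²) ∖ {i₂ 0}` (with `S² × {t₀}` and `{s₀} × T²` off the puncture), and a smooth submersion
`π : P → T²` with `π (jB (s₀, t)) = t` and `π⁻¹(t₀) = jB(S² × {t₀})`: there is a diffeomorphism
`Φ : P ≅ S² × T²` with `Φ(jB(S² × {t₀})) = S² × {t₁}` and `Φ(jB({s₀} × T²)) = {s₁} × T²` for some
`s₁, t₁`.  Proof in print: `π` is proper and surjective, so by Ehresmann `P → T²` is a smooth bundle
whose fibre is `π⁻¹(t₀) ≅ S²`; the section `t ↦ jB (s₀, t)` has the product neighbourhood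
`jB((S² ∖ {(i₂ 0).1}) × T²)`, so square `0`; an `S²`-bundle over `T²` with a section of even square is
the trivial one, a square-`0` section of `S² × T²` is `T + 0·F`, i.e. the graph of a degree-`0`, hence
null-homotopic, map `T² → S²`, which lifts to `SO(3)` and is straightened by the fibrewise rotation;
compose.  Size: L–XL (Ehresmann, `Diff(S²) ≃ O(3)` or the classification of `S²`-bundles over `T²`,
tubular neighbourhoods).  Why it might fail: only as typed (it is classical); generality check: the
hypotheses force `P` connected and `P ≅ (S² × T²) # (homotopy sphere)`, nothing is assumed on `i₂`
beyond its centre.  [GompfStipsicz1999 §3.1; McDuffSalamon2017 §4.1 (vi); HirschDT1976 Ch. 4 §5;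
Smale1959DiffS2] -/
def Sig.stub_productModel : Prop :=
  ∀ (P : Type) [TopologicalSpace P] [T2Space P] [SecondCountableTopology P] [ChartedSpace 𝔼⁴ P]
    [IsManifold (𝓡 4) ∞ P] [CompactSpace P]
    (i₂ : 𝔼⁴ → ↥𝕊² × 𝕋²) (jB : ↥(puncture i₂) → P) (s₀ : ↥𝕊²) (t₀ : 𝕋²)
    (hF : ∀ s : ↥𝕊², (s, t₀) ∈ puncture i₂) (hT : ∀ t : 𝕋², (s₀, t) ∈ puncture i₂),
    Manifold.IsSmoothEmbedding ((𝓡 2).prod ((𝓡 1).prod (𝓡 1))) (𝓡 4) ∞ jB → IsOpen (Set.range jB) →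
    ∀ π : P → 𝕋², ContMDiff (𝓡 4) ((𝓡 1).prod (𝓡 1)) ∞ π → (∀ x : P, Function.Surjective (mfderiv (𝓡 4) ((𝓡 1).prod (𝓡 1)) π x)) →
      (∀ t : 𝕋², π (jB ⟨(s₀, t), hT t⟩) = t) →
      (∀ x : P, π x = t₀ ↔ x ∈ Set.range (fun s : ↥𝕊² => jB ⟨(s, t₀), hF s⟩)) →
      ∃ (Φ : P ≃ₘ⟮𝓡 4, ((𝓡 2).prod ((𝓡 1).prod (𝓡 1)))⟯ (↥𝕊² × 𝕋²)) (s₁ : ↥𝕊²) (t₁ : 𝕋²),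
        Φ '' Set.range (fun s : ↥𝕊² => jB ⟨(s, t₀), hF s⟩) = Prod.snd ⁻¹' {t₁} ∧
        Φ '' Set.range (fun t : 𝕋² => jB ⟨(s₀, t), hT t⟩) = Prod.fst ⁻¹' {s₁}

/-- **STUB 3 — THE COMPLEMENT OF FIBRE ∪ SECTION: A `1`-HANDLEBODY SUM `Y # M ≅ Y`** (known;
Kervaire–Milnor sums, tubular neighbourhoods, plumbing).  From the gluing clauses `IsHostSum M P i₁ i₂
jA jB` of `P = M # (S² × T²)` and a diffeomorphism of triples `Φ : (P; jB F, jB T) ≅ (S² × T²;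
S² × {t₁}, {s₁} × T²)`, there are a compact connected orientable smooth `4`-manifold with boundary `Y`
which is a `1`-handlebody (`IsHandlebodyOfIndexLE 3 1 Y`, `IsOrientable (𝓡∂ 4) Y`) and an interior
connected sum `V` of `Y` with `M` (`IsConnectedSum (𝓡∂ 4) (𝓡∂ 4) (𝓡 4) Y M V`) diffeomorphic to `Y`.
Proof in print: `Y := S² × T² ∖ ν°` for a smooth regular neighbourhood `ν` of the standard pair
`S² × {t₁} ∪ {s₁} × T²` (it is `D² × T₀`, `T₀ = T² ∖` open disc, with corners smoothed: a `0`-handle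
and two `1`-handles, `≅ ♮2(S¹ × B³)`, orientable); `Φ⁻¹(ν)` is a regular neighbourhood of
`jB F ∪ jB T` inside `range jB`, missing the capped-off end for `ν` thin, so `P ∖ Φ⁻¹(ν°)` is, after
re-presenting the Kervaire–Milnor sum with discs shrunk away from the pair (radial re-parametrisation
on the `M`-side keeps `jB` fixed), an interior sum `Y' # M` with `Y' ≅ Y` (uniqueness of regular
neighbourhoods of the plumbed pair), while `Φ` maps it onto `Y`.  Size: L–XL.  Why it might fail: only
as typed (the boundary-model bookkeeping `𝓡∂ 4`, smoothing the corners of `D² × T₀`); stated for every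
`M` with the Statement's instance binders (no `e` needed).  [KervaireMilnor1963 §2; HirschDT1976
Ch. 4 §§5–6; GompfStipsicz1999 §4.6.2; Kosinski1993 VI] -/
def Sig.stub_complementSum : Prop :=
  ∀ (M : Type) [TopologicalSpace M] [T2Space M] [SecondCountableTopology M] [ChartedSpace 𝔼⁴ M]
    [IsManifold (𝓡 4) ∞ M]
    (P : Type) [TopologicalSpace P] [T2Space P] [SecondCountableTopology P] [ChartedSpace 𝔼⁴ P]
    [IsManifold (𝓡 4) ∞ P] [CompactSpace P]
    (i₁ : 𝔼⁴ → M) (i₂ : 𝔼⁴ → ↥𝕊² × 𝕋²) (jA : ↥(puncture i₁) → P) (jB : ↥(puncture i₂) → P)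
    (s₀ : ↥𝕊²) (t₀ : 𝕋²) (hF : ∀ s : ↥𝕊², (s, t₀) ∈ puncture i₂) (hT : ∀ t : 𝕋², (s₀, t) ∈ puncture i₂),
    IsHostSum M P i₁ i₂ jA jB →
    ∀ (Φ : P ≃ₘ⟮𝓡 4, ((𝓡 2).prod ((𝓡 1).prod (𝓡 1)))⟯ (↥𝕊² × 𝕋²)) (s₁ : ↥𝕊²) (t₁ : 𝕋²),
      Φ '' Set.range (fun s : ↥𝕊² => jB ⟨(s, t₀), hF s⟩) = Prod.snd ⁻¹' {t₁} →
      Φ '' Set.range (fun t : 𝕋² => jB ⟨(s₀, t), hT t⟩) = Prod.fst ⁻¹' {s₁} →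
      ∃ (Y : Type) (_ : TopologicalSpace Y) (_ : T2Space Y) (_ : SecondCountableTopology Y)
        (_ : CompactSpace Y) (_ : ConnectedSpace Y) (_ : ChartedSpace (EuclideanHalfSpace 4) Y)
        (_ : IsManifold (𝓡∂ 4) ∞ Y)
        (V : Type) (_ : TopologicalSpace V) (_ : T2Space V) (_ : SecondCountableTopology V)
        (_ : CompactSpace V) (_ : ChartedSpace (EuclideanHalfSpace 4) V) (_ : IsManifold (𝓡∂ 4) ∞ V),
        IsHandlebodyOfIndexLE 3 1 Y ∧ IsOrientable (𝓡∂ 4) Y ∧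
          IsConnectedSum (𝓡∂ 4) (𝓡∂ 4) (𝓡 4) Y M V ∧ Nonempty (V ≃ₘ⟮𝓡∂ 4, 𝓡∂ 4⟯ Y)

/-- **STUB 4 — `1`-HANDLEBODIES ABSORB NO CLOSED 4-MANIFOLD** (Laudenbach–Poénaru cancellation).
If `Y` is a compact connected orientable smooth `4`-manifold with boundary which is a `1`-handlebody
and some interior connected sum `V` of `Y` with a smooth `4`-manifold `M` is diffeomorphic to `Y`,
then `M ≅ S⁴`.  Proof in print: `Y ≅ Y₀ = ♮k(S¹ × B³)` (uniqueness of connected orientable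
`1`-handlebodies; tree `OneHandlebodyClassification.lean`), and `S⁴ = Y₀ ∪_∂ Z₀` with `Z₀ = ♮k(S² × D²)`
a `2`-handlebody (`S⁴ = ∂(D² × D³)` summed `k` times); then `M ≅ M # S⁴ ≅ (M # Y₀) ∪_∂ Z₀ ≅ Y₀ ∪_φ Z₀`
for the induced boundary diffeomorphism `φ`, and `Y₀ ∪_φ Z₀ ≅ Y₀ ∪_id Z₀ = S⁴` because every
diffeomorphism of `∂Y₀ = #k(S¹ × S²)` extends over `Y₀` (Laudenbach–Poénaru 1972, Thm. A; tree named
facts `exists_diffeomorph_comp_incl_eq` / `nonempty_diffeomorph_of_isBoundaryGluing_twoHandlebody`,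
SPC4Handles.lean, with their decomposition in `LaudenbachPoenaruPositiveGenus.lean`; `k = 0` is Cerf).
Either pairing of the orientation-free `IsConnectedSum` is covered since `Y₀` admits an
orientation-reversing diffeomorphism; a non-compact, empty or disconnected `M` cannot occur
(`V ≅ Y` is compact connected and `IsConnectedSum` needs a disc in `M`).  Size: L–XL (XL if the
Laudenbach–Poénaru fact is to be discharged rather than consumed).  Why it might fail: only as typed.
[LaudenbachPoenaruBSMF1972 Thm. A; Kirby1989 Ch. I §2 (p. 8); GompfStipsicz1999 §4.4;
CerfDiffeoSphere1968; MilnorHCobordism1965 §9] -/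
def Sig.stub_handlebodyCancellation : Prop :=
  ∀ (Y : Type) [TopologicalSpace Y] [T2Space Y] [SecondCountableTopology Y] [CompactSpace Y]
    [ConnectedSpace Y] [ChartedSpace (EuclideanHalfSpace 4) Y] [IsManifold (𝓡∂ 4) ∞ Y]
    (M : Type) [TopologicalSpace M] [T2Space M] [SecondCountableTopology M] [ChartedSpace 𝔼⁴ M]
    [IsManifold (𝓡 4) ∞ M]
    (V : Type) [TopologicalSpace V] [T2Space V] [SecondCountableTopology V] [CompactSpace V]
    [ChartedSpace (EuclideanHalfSpace 4) V] [IsManifold (𝓡∂ 4) ∞ V],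
    IsHandlebodyOfIndexLE 3 1 Y → IsOrientable (𝓡∂ 4) Y →
    IsConnectedSum (𝓡∂ 4) (𝓡∂ 4) (𝓡 4) Y M V → Nonempty (V ≃ₘ⟮𝓡∂ 4, 𝓡∂ 4⟯ Y) →
    Nonempty (M ≃ₘ⟮𝓡 4, 𝓡 4⟯ 𝕊⁴)

/-! ## §2 The registered stubs (the ONLY `sorry`s of this file) -/

/-- Registered stub 1 (OPEN as a formal object, the heart; XL): the host sum is ruled over the torus
with the marked torus a section and the marked sphere a fibre.  See `Sig.stub_ruling`. -/
theorem stub_ruling : Sig.stub_ruling := by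
  sorry

/-- Registered stub 2 (known, L–XL): a sphere-ruled host with the marked pair a fibre and a section is
the product triple.  See `Sig.stub_productModel`. -/
theorem stub_productModel : Sig.stub_productModel := by
  sorry

/-- Registered stub 3 (known, L–XL): the complement of fibre ∪ section is a `1`-handlebody sum
`Y # M ≅ Y`.  See `Sig.stub_complementSum`. -/
theorem stub_complementSum : Sig.stub_complementSum := by
  sorry

/-- Registered stub 4 (known modulo Laudenbach–Poénaru, L–XL): `1`-handlebodies absorb no closed
4-manifold.  See `Sig.stub_handlebodyCancellation`. -/
theorem stub_handlebodyCancellation : Sig.stub_handlebodyCancellation := by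
  sorry

/-! ## §3 The composition — the crux BY NAME from the four stubs (real proof, no `sorry`) -/

/-- **Skeleton theorem.**  Ruling, product model, complement and cancellation imply the crux
`Theses.EllipticRuledHost.CappingRecogniser` BY NAME.  Fix `Σ = (M, e)` and the crux's witness bundle
`(P, i₁, i₂, jA, jB, s₀, t₀, hF, hT, sf)` with its fourteen clauses `h`.  Stub 1 rules `P` over `T²`
(`π`); stub 2 turns `(P; jB F, jB T)` into the product triple (`Φ`), using only the two `jB`-clauses
of `h`; stub 3 reads off the `1`-handlebody sum `V = Y # M ≅ Y` from the eight gluing clauses and `Φ`;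
stub 4 cancels the handlebody: `M ≅ S⁴`. -/
theorem CappingRecogniser_of :
    Sig.stub_ruling → Sig.stub_productModel → Sig.stub_complementSum →
      Sig.stub_handlebodyCancellation →
        Summit.SmoothPoincare4.SmoothPoincare4.Theses.EllipticRuledHost.CappingRecogniser := by
  intro hRule hProd hCompl hCancel M _ _ _ _ _ e hX
  -- the crux's witness bundle and its fourteen clauses
  obtain ⟨P, _, _, _, _, _, _, i₁, i₂, jA, jB, s₀, t₀, hF, hT, sf, h⟩ := hX
  -- stub 1: the ruling `π : P → T²` (torus = section on the nose, sphere = fibre over `t₀`)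
  obtain ⟨π, hπ, hsub, hsec, hfib⟩ := hRule M e P i₁ i₂ jA jB s₀ t₀ hF hT sf h
  -- stub 2: the product model `Φ : (P; jB F, jB T) ≅ (S² × T²; S² × {t₁}, {s₁} × T²)`
  obtain ⟨Φ, s₁, t₁, hΦF, hΦT⟩ :=
    hProd P i₂ jB s₀ t₀ hF hT h.2.2.2.2.1 h.2.2.2.2.2.1 π hπ hsub hsec hfib
  -- stub 3: the complement of fibre ∪ section, a 1-handlebody sum `V = Y # M ≅ Y`
  obtain ⟨Y, _, _, _, _, _, _, _, V, _, _, _, _, _, _, hY, hYo, hsum, hVY⟩ :=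
    hCompl M P i₁ i₂ jA jB s₀ t₀ hF hT
      ⟨h.1, h.2.1, h.2.2.1, h.2.2.2.1, h.2.2.2.2.1, h.2.2.2.2.2.1, h.2.2.2.2.2.2.1, h.2.2.2.2.2.2.2.1⟩
      Φ s₁ t₁ hΦF hΦT
  -- stub 4: Laudenbach–Poénaru cancellation
  exact hCancel Y M V hY hYo hsum hVY

/-- The crux by name, closed modulo the four registered stubs (its axiom closure contains `sorryAx`
through the stubs only; `CappingRecogniser_of` itself is sorry-free). -/
theorem cappingRecogniser_of_stubs :
    Summit.SmoothPoincare4.SmoothPoincare4.Theses.EllipticRuledHost.CappingRecogniser :=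
  CappingRecogniser_of stub_ruling stub_productModel stub_complementSum stub_handlebodyCancellation

end Summit.SmoothPoincare4.SmoothPoincare4.Cruxes.CappingRecogniser.Birth

end
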